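import Mathlib.Topology.Algebra.Category.ProfiniteGrp.Completion
import HarnessLib

/-!
# Profinitely inner endomorphisms are invisible to finite abelian quotients

Topic `Literature/GroupTheory` (abc-iut cell, campaign-L R1.2; seat abc-iut-w5-d144 gen 4 — the first,
group-theoretic step of every closer of the residual (OUT) «`Aut(X) → Out(π̂₁(X^top))` injective» of
[AbsTopIII] Prop. 4.2 (i): an automorphism acting innerly on `π̂₁` acts trivially on `H₁` with finite
coefficients).  For a group `G` with profinite completion `ι : G → Ĝ` (Mathlib's
`ProfiniteGrp.ProfiniteCompletion`):

* `map_eq_of_eta_conj` — if an endomorphism `θ` of `G` is INNER IN `Ĝ` (`ι(θ g) = n⁻¹ ι(g) n` for some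
  `n ∈ Ĝ`), then `χ (θ g) = χ g` for every homomorphism `χ : G → A` to a FINITE COMMUTATIVE group
  (`χ` extends continuously to `Ĝ`, where conjugation by `n` is killed by commutativity);
* `map_eq_of_eta_conj_of_separating` — the same for `A` commutative and separated by its finite
  quotients (residually finite, e.g. `ℤⁿ`: winding numbers, periods), by reduction to them.

Elementary; no definitions, no instances, no named facts. [cite: RibesZalesskii2010, §3.2]
-/

noncomputable section

open CategoryTheory ProfiniteGrp

universe u

namespace Literature.GroupTheory

/-- **A profinitely inner endomorphism is invisible to every finite commutative quotient.**  If
`θ : G → G` satisfies `ι(θ g) = n⁻¹ ι(g) n` in the profinite completion `Ĝ` for some `n ∈ Ĝ`, then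
`χ ∘ θ = χ` for every homomorphism `χ` from `G` to a finite commutative group.
[cite: RibesZalesskii2010, §3.2 (universal property of the profinite completion)] -/
theorem map_eq_of_eta_conj {G : Type u} [Group G] {A : Type u} [CommGroup A] [Finite A]
    (θ : G →* G) (n : ProfiniteCompletion.completion (GrpCat.of G))
    (hn : ∀ g : G, ProfiniteCompletion.etaFn (GrpCat.of G) (θ g) =
      n⁻¹ * ProfiniteCompletion.etaFn (GrpCat.of G) g * n)
    (χ : G →* A) (g : G) : χ (θ g) = χ g := by
  letI : TopologicalSpace A := ⊥
  haveI : DiscreteTopology A := ⟨rfl⟩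
  haveI : IsTopologicalGroup A :=
    { continuous_mul := continuous_of_discreteTopology
      continuous_inv := continuous_of_discreteTopology }
  let P : ProfiniteGrp.{u} := ProfiniteGrp.of A
  let χhat := ProfiniteCompletion.lift (G := GrpCat.of G) (P := P) (GrpCat.ofHom χ)
  have hχ : ∀ g : G, χhat.hom (ProfiniteCompletion.etaFn (GrpCat.of G) g) = χ g := fun g => by
    have h := ProfiniteCompletion.lift_eta (G := GrpCat.of G) (P := P) (GrpCat.ofHom χ)
    exact congrArg (fun f => (f : G →* _) g) (congrArg GrpCat.Hom.hom h)
  rw [← hχ (θ g), hn g, map_mul, map_mul, map_inv, ← hχ g]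
  have key : ∀ a b : P, a⁻¹ * b * a = b := fun a b => by
    rw [mul_comm a⁻¹ b, mul_assoc, inv_mul_cancel, mul_one]
  exact key _ _

/-- **The same for commutative targets separated by their finite quotients** (residually finite
abelian groups, e.g. `ℤⁿ`): if every `a ≠ 1` of `A` is detected by a homomorphism to a finite
commutative group, a profinitely inner `θ` satisfies `χ ∘ θ = χ` for every `χ : G → A`.
[cite: RibesZalesskii2010, §3.2] -/
theorem map_eq_of_eta_conj_of_separating {G : Type u} [Group G] {A : Type u} [CommGroup A]
    (hA : ∀ a : A, a ≠ 1 → ∃ (B : Type u) (_ : CommGroup B) (_ : Finite B) (ψ : A →* B), ψ a ≠ 1)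
    (θ : G →* G) (n : ProfiniteCompletion.completion (GrpCat.of G))
    (hn : ∀ g : G, ProfiniteCompletion.etaFn (GrpCat.of G) (θ g) =
      n⁻¹ * ProfiniteCompletion.etaFn (GrpCat.of G) g * n)
    (χ : G →* A) (g : G) : χ (θ g) = χ g := by
  by_contra h
  obtain ⟨B, _, _, ψ, hψ⟩ := hA (χ (θ g) * (χ g)⁻¹) (by rwa [Ne, mul_inv_eq_one])
  apply hψ
  rw [map_mul, map_inv, mul_inv_eq_one]
  exact map_eq_of_eta_conj θ n hn (ψ.comp χ) g

end Literature.GroupTheory
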